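import Summits.SmoothPoincare4.SmoothPoincare4.Theorems.SymplecticOrigamiOrigamiFoldExistenceStubCleanOnePleatIroningSeamSheet

/-!
# Stub `stub_cleanOnePleatIroning` of line `shadow-pleats` for crux `OrigamiFoldExistence` — XIV:
# sheet counting for a MODIFIED shadow (item stmt-SmoothPoincare4-7844, route SymplecticOrigami; seat c3, S5a worker, wave 2)

Fourteenth helper file for the registered stub `stub_cleanOnePleatIroning` (S5a): the
TOPOLOGICAL HALF (no foreign shadow over the ironed ball) of its remaining ingredient
`CleanPleatIroningChart` (file III) is the sheet count of `…StubPleatFreeStandardSheets`, run for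
an abstract MODIFIED SHADOW `σ : M → ℝ⁴` of a round-rim position `(ι, δ)` (smooth, immersive
above the plane, equal to the shadow `proj5 ∘ ι` near every point on or below the plane; the
old heights `h = (ι ·) 4` are kept) — applied in the final file to the shadow of the patched
map, which is not yet known to be an embedding.  `σ` is a local diffeomorphism at positive
height (`exists_nhds_injOn_sigma`); MAXIMUM PRINCIPLE (`norm_sigma_le/lt`): `{h > 1 - δ}` is
mapped into the open ball of radius `ρ = √(1 - (1 - δ)²)`; over some (`exists_good_point_sigma`)
hence, by a connectedness count, over EVERY point of that ball `{h > 1 - δ}` has exactly one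
`σ`-preimage (`existsUnique_preimage_sigma`, registered sub-goal).
Sources: `…StubPleatFreeStandardSheets` (seat 1), whose proofs (`exists_nhds_injOn`,
`not_lt_height_of_isMaxOn`, `norm_shadow_le/lt`, `exists_good_point`, `existsUnique_preimage`)
are adapted verbatim with `σ` for `proj5 ∘ ι`; file V (`…SeamSheet`).
-/

noncomputable section

-- the prescribed namespace `Summit.<P>.<Sub>.…` duplicates `SmoothPoincare4` (P = Sub)
set_option linter.dupNamespace false

open scoped Manifold ContDiff Topology RealInnerProductSpace
open Set Function Filter Metric

namespace Summit.SmoothPoincare4.SmoothPoincare4.Theorems.OrigamiFoldExistence.ShadowPleats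

section Sigma

variable {M : Type} [TopologicalSpace M] [ChartedSpace (EuclideanSpace ℝ (Fin 4)) M]
  [IsManifold (𝓡 4) ∞ M] {ι : M → EuclideanSpace ℝ (Fin 5)} {δ : ℝ}
  {σ : M → EuclideanSpace ℝ (Fin 4)}

omit [ChartedSpace (EuclideanSpace ℝ (Fin 4)) M] [IsManifold (𝓡 4) ∞ M] in
/-- On and below the plane the modified shadow is the shadow. -/
theorem sigma_eq_of_le (hσeq : ∀ m : M, ι m 4 ≤ 1 - δ → σ =ᶠ[𝓝 m] proj5 ∘ ι) {m : M}
    (hm : ι m 4 ≤ 1 - δ) : σ m = proj5 (ι m) :=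
  (hσeq m hm).eq_of_nhds

/-- **The modified shadow is immersive at every point of positive height**: above the plane
by hypothesis, on and below it because it is the old shadow there (file V). -/
theorem injective_mfderiv_sigma_of_pos (hι : Manifold.IsSmoothEmbedding (𝓡 4) (𝓡 5) ∞ ι)
    (hδ : 0 < δ) (hδ1 : δ < 1)
    (hround : Set.range ι ∩ {p : EuclideanSpace ℝ (Fin 5) | p 4 ≤ 1 - δ} =
      (Metric.sphere (0 : EuclideanSpace ℝ (Fin 5)) 1 : Set (EuclideanSpace ℝ (Fin 5))) ∩
        {p : EuclideanSpace ℝ (Fin 5) | p 4 ≤ 1 - δ})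
    (hσinj : ∀ m : M, 1 - δ < ι m 4 → Injective (mfderiv (𝓡 4) (𝓡 4) σ m))
    (hσeq : ∀ m : M, ι m 4 ≤ 1 - δ → σ =ᶠ[𝓝 m] proj5 ∘ ι)
    {m : M} (hpos : 0 < ι m 4) : Injective (mfderiv (𝓡 4) (𝓡 4) σ m) := by
  by_cases hgt : 1 - δ < ι m 4
  · exact hσinj m hgt
  · rw [(hσeq m (not_lt.1 hgt)).mfderiv_eq]
    exact injective_mfderiv_shadow_of_le hι hδ hδ1 hround hpos (not_lt.1 hgt)

/-- At a point of positive height the modified shadow is an injective open map on a small open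
neighbourhood inside any prescribed open set. -/
theorem exists_nhds_injOn_sigma (hι : Manifold.IsSmoothEmbedding (𝓡 4) (𝓡 5) ∞ ι)
    (hδ : 0 < δ) (hδ1 : δ < 1)
    (hround : Set.range ι ∩ {p : EuclideanSpace ℝ (Fin 5) | p 4 ≤ 1 - δ} =
      (Metric.sphere (0 : EuclideanSpace ℝ (Fin 5)) 1 : Set (EuclideanSpace ℝ (Fin 5))) ∩
        {p : EuclideanSpace ℝ (Fin 5) | p 4 ≤ 1 - δ})
    (hσ : ContMDiff (𝓡 4) (𝓡 4) ∞ σ)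
    (hσinj : ∀ m : M, 1 - δ < ι m 4 → Injective (mfderiv (𝓡 4) (𝓡 4) σ m))
    (hσeq : ∀ m : M, ι m 4 ≤ 1 - δ → σ =ᶠ[𝓝 m] proj5 ∘ ι)
    {m : M} (hpos : 0 < ι m 4) {W : Set M} (hW : IsOpen W) (hmW : m ∈ W) :
    ∃ U : Set M, IsOpen U ∧ m ∈ U ∧ U ⊆ W ∧ InjOn σ U ∧
      ∀ V, V ⊆ U → IsOpen V → IsOpen (σ '' V) := by
  obtain ⟨Φ, hmΦ, heq⟩ := isLocalDiffeomorphAt_of_injective_mfderiv_four hσ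
    (injective_mfderiv_sigma_of_pos hι hδ hδ1 hround hσinj hσeq hpos)
  refine ⟨Φ.source ∩ W, Φ.open_source.inter hW, ⟨hmΦ, hmW⟩, inter_subset_right, ?_, ?_⟩
  · intro a ha b hb hab
    have hab' : Φ a = Φ b := by rw [← heq ha.1, ← heq hb.1]; exact hab
    exact Φ.toPartialEquiv.injOn ha.1 hb.1 hab'
  · intro V hV hVopen
    have hVs : V ⊆ Φ.source := fun x hx => (hV hx).1
    have himg : σ '' V = Φ.toOpenPartialHomeomorph '' V :=
      image_congr fun x hx => heq (hVs hx)
    rw [himg]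
    exact Φ.toOpenPartialHomeomorph.isOpen_image_of_subset_source hVopen hVs

omit [ChartedSpace (EuclideanSpace ℝ (Fin 4)) M] [IsManifold (𝓡 4) ∞ M] in
/-- On the seam the modified shadow has norm exactly `ρ`. -/
theorem norm_sigma_of_seam
    (hround : Set.range ι ∩ {p : EuclideanSpace ℝ (Fin 5) | p 4 ≤ 1 - δ} =
      (Metric.sphere (0 : EuclideanSpace ℝ (Fin 5)) 1 : Set (EuclideanSpace ℝ (Fin 5))) ∩
        {p : EuclideanSpace ℝ (Fin 5) | p 4 ≤ 1 - δ})
    (hσeq : ∀ m : M, ι m 4 ≤ 1 - δ → σ =ᶠ[𝓝 m] proj5 ∘ ι)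
    {m : M} (hm : ι m 4 = 1 - δ) : ‖σ m‖ = Real.sqrt (1 - (1 - δ) ^ 2) := by
  rw [sigma_eq_of_le hσeq hm.le]
  exact norm_shadow_of_seam hround hm

omit [ChartedSpace (EuclideanSpace ℝ (Fin 4)) M] [IsManifold (𝓡 4) ∞ M] in
/-- A point on or above the plane whose modified shadow has norm `< ρ` is strictly above. -/
theorem lt_height_of_norm_sigma_lt
    (hround : Set.range ι ∩ {p : EuclideanSpace ℝ (Fin 5) | p 4 ≤ 1 - δ} =
      (Metric.sphere (0 : EuclideanSpace ℝ (Fin 5)) 1 : Set (EuclideanSpace ℝ (Fin 5))) ∩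
        {p : EuclideanSpace ℝ (Fin 5) | p 4 ≤ 1 - δ})
    (hσeq : ∀ m : M, ι m 4 ≤ 1 - δ → σ =ᶠ[𝓝 m] proj5 ∘ ι)
    {m : M} (hK : 1 - δ ≤ ι m 4) (hn : ‖σ m‖ < Real.sqrt (1 - (1 - δ) ^ 2)) :
    1 - δ < ι m 4 := by
  rcases hK.lt_or_eq with h | h
  · exact h
  · exact absurd (norm_sigma_of_seam hround hσeq h.symm) hn.ne

/-! ### The maximum principle for the modified shadow -/

/-- **No interior maximum** of `‖σ‖` on `K = {h ≥ 1 - δ}` strictly above the plane. -/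
theorem not_lt_height_of_isMaxOn_sigma (hι : Manifold.IsSmoothEmbedding (𝓡 4) (𝓡 5) ∞ ι)
    (hδ : 0 < δ) (hδ1 : δ < 1)
    (hround : Set.range ι ∩ {p : EuclideanSpace ℝ (Fin 5) | p 4 ≤ 1 - δ} =
      (Metric.sphere (0 : EuclideanSpace ℝ (Fin 5)) 1 : Set (EuclideanSpace ℝ (Fin 5))) ∩
        {p : EuclideanSpace ℝ (Fin 5) | p 4 ≤ 1 - δ})
    (hσ : ContMDiff (𝓡 4) (𝓡 4) ∞ σ)
    (hσinj : ∀ m : M, 1 - δ < ι m 4 → Injective (mfderiv (𝓡 4) (𝓡 4) σ m))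
    (hσeq : ∀ m : M, ι m 4 ≤ 1 - δ → σ =ᶠ[𝓝 m] proj5 ∘ ι)
    {m₀ : M} (hmax : IsMaxOn (fun m => ‖σ m‖) {m : M | 1 - δ ≤ ι m 4} m₀) :
    ¬ 1 - δ < ι m₀ 4 := by
  intro hgt
  have hpos : 0 < ι m₀ 4 := by linarith
  have hopen : IsOpen {m : M | 1 - δ < ι m 4} := isOpen_lt continuous_const (continuous_height hι)
  obtain ⟨U, hU, hmU, hUW, -, himg⟩ :=
    exists_nhds_injOn_sigma hι hδ hδ1 hround hσ hσinj hσeq hpos hopen hgt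
  have hUimg : IsOpen (σ '' U) := himg U Subset.rfl hU
  set x₀ : EuclideanSpace ℝ (Fin 4) := σ m₀ with hx₀
  have hx₀mem : x₀ ∈ σ '' U := ⟨m₀, hmU, rfl⟩
  obtain ⟨ε, hε, hball⟩ := Metric.isOpen_iff.1 hUimg x₀ hx₀mem
  have hle : ∀ m ∈ U, ‖σ m‖ ≤ ‖x₀‖ := fun m hm =>
    hmax (show (1 : ℝ) - δ ≤ ι m 4 from (hUW hm).le)
  by_cases hx : x₀ = 0
  · obtain ⟨ms, hms⟩ := exists_seam hδ hδ1 hround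
    have h1 : ‖σ ms‖ ≤ ‖x₀‖ := hmax (show (1 : ℝ) - δ ≤ ι ms 4 from le_of_eq hms.symm)
    rw [norm_sigma_of_seam hround hσeq hms, hx, norm_zero] at h1
    have h2 : 0 < Real.sqrt (1 - (1 - δ) ^ 2) := Real.sqrt_pos.2 (by nlinarith)
    linarith
  · have hxpos : 0 < ‖x₀‖ := norm_pos_iff.2 hx
    set t : ℝ := ε / (2 * ‖x₀‖) with ht
    have htpos : 0 < t := by positivity
    have hy : (1 + t) • x₀ ∈ Metric.ball x₀ ε := by
      rw [Metric.mem_ball, dist_eq_norm, add_smul, one_smul, add_sub_cancel_left, norm_smul,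
        Real.norm_eq_abs, abs_of_pos htpos, ht]
      field_simp
      linarith
    obtain ⟨m', hm'U, hm'x⟩ := hball hy
    have h1 := hle m' hm'U
    have h2 : ‖σ m'‖ = (1 + t) * ‖x₀‖ := by
      rw [hm'x, norm_smul, Real.norm_eq_abs, abs_of_pos (by linarith)]
    rw [h2] at h1
    nlinarith

/-- **`σ(K) ⊆ B̄_ρ`** for the compact `K = {h ≥ 1 - δ}`. -/
theorem norm_sigma_le [CompactSpace M] (hι : Manifold.IsSmoothEmbedding (𝓡 4) (𝓡 5) ∞ ι)
    (hδ : 0 < δ) (hδ1 : δ < 1)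
    (hround : Set.range ι ∩ {p : EuclideanSpace ℝ (Fin 5) | p 4 ≤ 1 - δ} =
      (Metric.sphere (0 : EuclideanSpace ℝ (Fin 5)) 1 : Set (EuclideanSpace ℝ (Fin 5))) ∩
        {p : EuclideanSpace ℝ (Fin 5) | p 4 ≤ 1 - δ})
    (hσ : ContMDiff (𝓡 4) (𝓡 4) ∞ σ)
    (hσinj : ∀ m : M, 1 - δ < ι m 4 → Injective (mfderiv (𝓡 4) (𝓡 4) σ m))
    (hσeq : ∀ m : M, ι m 4 ≤ 1 - δ → σ =ᶠ[𝓝 m] proj5 ∘ ι)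
    {m : M} (hm : 1 - δ ≤ ι m 4) : ‖σ m‖ ≤ Real.sqrt (1 - (1 - δ) ^ 2) := by
  have hK : IsCompact {m : M | 1 - δ ≤ ι m 4} :=
    (isClosed_le continuous_const (continuous_height hι)).isCompact
  obtain ⟨ms, hms⟩ := exists_seam hδ hδ1 hround
  have hne : ({m : M | 1 - δ ≤ ι m 4}).Nonempty := ⟨ms, le_of_eq hms.symm⟩
  have hcont : Continuous fun m => ‖σ m‖ := hσ.continuous.norm
  obtain ⟨m₀, hm₀K, hmax⟩ := hK.exists_isMaxOn hne hcont.continuousOn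
  have hm₀eq : ι m₀ 4 = 1 - δ := by
    have := not_lt_height_of_isMaxOn_sigma hι hδ hδ1 hround hσ hσinj hσeq hmax
    exact le_antisymm (not_lt.1 this) hm₀K
  calc ‖σ m‖ ≤ ‖σ m₀‖ := hmax hm
    _ = Real.sqrt (1 - (1 - δ) ^ 2) := norm_sigma_of_seam hround hσeq hm₀eq

/-- **Strictly above the plane `σ` lands in the OPEN ball of radius `ρ`.** -/
theorem norm_sigma_lt [CompactSpace M] (hι : Manifold.IsSmoothEmbedding (𝓡 4) (𝓡 5) ∞ ι)
    (hδ : 0 < δ) (hδ1 : δ < 1)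
    (hround : Set.range ι ∩ {p : EuclideanSpace ℝ (Fin 5) | p 4 ≤ 1 - δ} =
      (Metric.sphere (0 : EuclideanSpace ℝ (Fin 5)) 1 : Set (EuclideanSpace ℝ (Fin 5))) ∩
        {p : EuclideanSpace ℝ (Fin 5) | p 4 ≤ 1 - δ})
    (hσ : ContMDiff (𝓡 4) (𝓡 4) ∞ σ)
    (hσinj : ∀ m : M, 1 - δ < ι m 4 → Injective (mfderiv (𝓡 4) (𝓡 4) σ m))
    (hσeq : ∀ m : M, ι m 4 ≤ 1 - δ → σ =ᶠ[𝓝 m] proj5 ∘ ι)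
    {m : M} (hm : 1 - δ < ι m 4) : ‖σ m‖ < Real.sqrt (1 - (1 - δ) ^ 2) := by
  rcases (norm_sigma_le hι hδ hδ1 hround hσ hσinj hσeq hm.le).lt_or_eq with h | h
  · exact h
  · exfalso
    have hmax : IsMaxOn (fun m => ‖σ m‖) {m : M | 1 - δ ≤ ι m 4} m := by
      intro m' hm'
      have := norm_sigma_le hι hδ hδ1 hround hσ hσinj hσeq hm'
      simpa only [mem_setOf_eq, h] using this
    exact not_lt_height_of_isMaxOn_sigma hι hδ hδ1 hround hσ hσinj hσeq hmax hm

/-! ### One sheet near the rim -/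

/-- **Exactly one sheet near the rim.**  Over some point of the open ball of radius `ρ` the part
`{h > 1 - δ}` has exactly one `σ`-preimage. -/
theorem exists_good_point_sigma [CompactSpace M] (hι : Manifold.IsSmoothEmbedding (𝓡 4) (𝓡 5) ∞ ι)
    (hδ : 0 < δ) (hδ1 : δ < 1)
    (hround : Set.range ι ∩ {p : EuclideanSpace ℝ (Fin 5) | p 4 ≤ 1 - δ} =
      (Metric.sphere (0 : EuclideanSpace ℝ (Fin 5)) 1 : Set (EuclideanSpace ℝ (Fin 5))) ∩
        {p : EuclideanSpace ℝ (Fin 5) | p 4 ≤ 1 - δ})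
    (hσ : ContMDiff (𝓡 4) (𝓡 4) ∞ σ)
    (hσinj : ∀ m : M, 1 - δ < ι m 4 → Injective (mfderiv (𝓡 4) (𝓡 4) σ m))
    (hσeq : ∀ m : M, ι m 4 ≤ 1 - δ → σ =ᶠ[𝓝 m] proj5 ∘ ι) :
    ∃ x : EuclideanSpace ℝ (Fin 4), ‖x‖ < Real.sqrt (1 - (1 - δ) ^ 2) ∧
      ∃ m₁ : M, 1 - δ < ι m₁ 4 ∧ σ m₁ = x ∧ ∀ m' : M, 1 - δ < ι m' 4 → σ m' = x → m' = m₁ := by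
  set ρ := Real.sqrt (1 - (1 - δ) ^ 2) with hρ
  have hρpos : 0 < ρ := Real.sqrt_pos.2 (by nlinarith)
  obtain ⟨ms, hms⟩ := exists_seam hδ hδ1 hround
  have hpos : 0 < ι ms 4 := by rw [hms]; linarith
  have hWopen : IsOpen {m : M | 0 < ι m 4} := isOpen_lt continuous_const (continuous_height hι)
  obtain ⟨U, hU, hmsU, hUW, hinjU, himg⟩ :=
    exists_nhds_injOn_sigma hι hδ hδ1 hround hσ hσinj hσeq hpos hWopen hpos
  set xs : EuclideanSpace ℝ (Fin 4) := σ ms with hxs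
  have hxsnorm : ‖xs‖ = ρ := norm_sigma_of_seam hround hσeq hms
  have hK : IsCompact {m : M | 1 - δ ≤ ι m 4} :=
    (isClosed_le continuous_const (continuous_height hι)).isCompact
  have hC : IsCompact ({m : M | 1 - δ ≤ ι m 4} \ U) := hK.diff hU
  have hcont : Continuous σ := hσ.continuous
  have hCimg : IsClosed (σ '' ({m : M | 1 - δ ≤ ι m 4} \ U)) := (hC.image hcont).isClosed
  have hxs_not : xs ∉ σ '' ({m : M | 1 - δ ≤ ι m 4} \ U) := by
    rintro ⟨c, ⟨hcK, hcU⟩, hcx⟩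
    have hcK' : 1 - δ ≤ ι c 4 := hcK
    have hceq : ι c 4 = 1 - δ := by
      rcases hcK'.lt_or_eq with h | h
      · have := norm_sigma_lt hι hδ hδ1 hround hσ hσinj hσeq h
        rw [hcx, hxsnorm] at this
        exact absurd this (lt_irrefl _)
      · exact h.symm
    have hshadow : proj5 (ι c) = proj5 (ι ms) := by
      rw [← sigma_eq_of_le hσeq hceq.le, ← sigma_eq_of_le hσeq hms.le]; exact hcx
    have hιeq : ι c = ι ms := by
      rw [← embedL_proj5_add_smul (ι c), ← embedL_proj5_add_smul (ι ms), hshadow, hceq, hms]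
    exact hcU (hι.isEmbedding.injective hιeq ▸ hmsU)
  obtain ⟨ε₁, hε₁, hball₁⟩ := Metric.isOpen_iff.1 hCimg.isOpen_compl xs hxs_not
  obtain ⟨ε₂, hε₂, hball₂⟩ := Metric.isOpen_iff.1 (himg U Subset.rfl hU) xs ⟨ms, hmsU, rfl⟩
  set t : ℝ := min (1 / 2) (min ε₁ ε₂ / (2 * ρ)) with ht
  have htpos : 0 < t := by positivity
  have htle : t ≤ 1 / 2 := min_le_left _ _
  have htρ : t * ρ < min ε₁ ε₂ := by
    have : t ≤ min ε₁ ε₂ / (2 * ρ) := min_le_right _ _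
    calc t * ρ ≤ min ε₁ ε₂ / (2 * ρ) * ρ := by gcongr
      _ = min ε₁ ε₂ / 2 := by field_simp
      _ < min ε₁ ε₂ := by linarith [lt_min hε₁ hε₂]
  set x : EuclideanSpace ℝ (Fin 4) := (1 - t) • xs with hx
  have hxdist : dist x xs = t * ρ := by
    rw [hx, dist_eq_norm, sub_smul, one_smul, sub_sub_cancel_left, norm_neg, norm_smul,
      Real.norm_eq_abs, abs_of_pos htpos, hxsnorm]
  have hxnorm : ‖x‖ < ρ := by
    rw [hx, norm_smul, Real.norm_eq_abs, abs_of_pos (by linarith), hxsnorm]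
    nlinarith
  have hx₁ : x ∈ Metric.ball xs ε₁ := by
    rw [Metric.mem_ball, hxdist]; exact lt_of_lt_of_le htρ (min_le_left _ _)
  have hx₂ : x ∈ Metric.ball xs ε₂ := by
    rw [Metric.mem_ball, hxdist]; exact lt_of_lt_of_le htρ (min_le_right _ _)
  obtain ⟨m₁, hm₁U, hm₁x⟩ := hball₂ hx₂
  have hm₁pos : 0 < ι m₁ 4 := hUW hm₁U
  have hm₁up : 1 - δ < ι m₁ 4 := by
    by_contra hle
    have := rho_le_norm_shadow hround hm₁pos (not_lt.1 hle)
    rw [← sigma_eq_of_le hσeq (not_lt.1 hle), hm₁x] at this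
    linarith
  refine ⟨x, hxnorm, m₁, hm₁up, hm₁x, fun m' hm' hm'x => ?_⟩
  have hm'U : m' ∈ U := by
    by_contra hnot
    have : x ∈ σ '' ({m : M | 1 - δ ≤ ι m 4} \ U) := ⟨m', ⟨hm'.le, hnot⟩, hm'x⟩
    exact hball₁ hx₁ this
  exact hinjU hm'U hm₁U (by rw [hm'x, hm₁x])

/-- **All fibres of a modified shadow over the open ball are singletons**: for every `x` with
`‖x‖ < ρ` there is exactly one point of `{h > 1 - δ}` with `σ`-value `x`. [folklore] -/
theorem existsUnique_preimage_sigma [CompactSpace M] [T2Space M]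
    (hι : Manifold.IsSmoothEmbedding (𝓡 4) (𝓡 5) ∞ ι) (hδ : 0 < δ) (hδ1 : δ < 1)
    (hround : Set.range ι ∩ {p : EuclideanSpace ℝ (Fin 5) | p 4 ≤ 1 - δ} =
      (Metric.sphere (0 : EuclideanSpace ℝ (Fin 5)) 1 : Set (EuclideanSpace ℝ (Fin 5))) ∩
        {p : EuclideanSpace ℝ (Fin 5) | p 4 ≤ 1 - δ})
    (hσ : ContMDiff (𝓡 4) (𝓡 4) ∞ σ)
    (hσinj : ∀ m : M, 1 - δ < ι m 4 → Injective (mfderiv (𝓡 4) (𝓡 4) σ m))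
    (hσeq : ∀ m : M, ι m 4 ≤ 1 - δ → σ =ᶠ[𝓝 m] proj5 ∘ ι)
    {x : EuclideanSpace ℝ (Fin 4)} (hx : ‖x‖ < Real.sqrt (1 - (1 - δ) ^ 2)) :
    ∃ m₁ : M, 1 - δ < ι m₁ 4 ∧ σ m₁ = x ∧ ∀ m' : M, 1 - δ < ι m' 4 → σ m' = x → m' = m₁ := by
  set ρ := Real.sqrt (1 - (1 - δ) ^ 2) with hρ
  set Good : EuclideanSpace ℝ (Fin 4) → Prop := fun y => ∃ m₁ : M, 1 - δ < ι m₁ 4 ∧ σ m₁ = y ∧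
      ∀ m' : M, 1 - δ < ι m' 4 → σ m' = y → m' = m₁ with hGood
  set Many : EuclideanSpace ℝ (Fin 4) → Prop := fun y => ∃ a b : M, 1 - δ < ι a 4 ∧ 1 - δ < ι b 4 ∧
      a ≠ b ∧ σ a = y ∧ σ b = y with hMany
  set None' : EuclideanSpace ℝ (Fin 4) → Prop := fun y => ∀ m' : M, 1 - δ < ι m' 4 → σ m' ≠ y with hNone
  have hK : IsCompact {m : M | 1 - δ ≤ ι m 4} :=
    (isClosed_le continuous_const (continuous_height hι)).isCompact
  have hcont : Continuous σ := hσ.continuous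
  have hMplus : IsOpen {m : M | 1 - δ < ι m 4} := isOpen_lt continuous_const (continuous_height hι)
  have htri : ∀ y : EuclideanSpace ℝ (Fin 4), Good y ∨ Many y ∨ None' y := by
    intro y
    by_cases hex : ∃ m₁ : M, 1 - δ < ι m₁ 4 ∧ σ m₁ = y
    · obtain ⟨m₁, hm₁, hm₁y⟩ := hex
      by_cases huniq : ∀ m' : M, 1 - δ < ι m' 4 → σ m' = y → m' = m₁
      · exact Or.inl ⟨m₁, hm₁, hm₁y, huniq⟩
      · push Not at huniq
        obtain ⟨m', hm', hm'y, hne⟩ := huniq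
        exact Or.inr (Or.inl ⟨m', m₁, hm', hm₁, hne, hm'y, hm₁y⟩)
    · push Not at hex
      exact Or.inr (Or.inr fun m' hm' h => hex m' hm' h)
  have hGoodOpen : IsOpen {y : EuclideanSpace ℝ (Fin 4) | ‖y‖ < ρ ∧ Good y} := by
    rw [Metric.isOpen_iff]
    rintro y ⟨hy, m₁, hm₁, hm₁y, huniq⟩
    obtain ⟨U, hU, hm₁U, hUW, hinjU, himg⟩ := exists_nhds_injOn_sigma hι hδ hδ1 hround hσ hσinj hσeq
      (by linarith : 0 < ι m₁ 4) hMplus hm₁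
    have hC : IsClosed (σ '' ({m : M | 1 - δ ≤ ι m 4} \ U)) := ((hK.diff hU).image hcont).isClosed
    have hy_not : y ∉ σ '' ({m : M | 1 - δ ≤ ι m 4} \ U) := by
      rintro ⟨c, ⟨hcK, hcU⟩, hcy⟩
      have hcK' : 1 - δ ≤ ι c 4 := hcK
      have hcup : 1 - δ < ι c 4 := lt_height_of_norm_sigma_lt hround hσeq hcK' (by rw [hcy]; exact hy)
      exact hcU (huniq c hcup hcy ▸ hm₁U)
    obtain ⟨ε₁, hε₁, hball₁⟩ := Metric.isOpen_iff.1 hC.isOpen_compl y hy_not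
    obtain ⟨ε₂, hε₂, hball₂⟩ := Metric.isOpen_iff.1 (himg U Subset.rfl hU) y ⟨m₁, hm₁U, hm₁y⟩
    obtain ⟨ε₃, hε₃, hball₃⟩ :=
      Metric.isOpen_iff.1 (Metric.isOpen_ball (x := (0 : EuclideanSpace ℝ (Fin 4))) (ε := ρ)) y (by simpa using hy)
    refine ⟨min ε₁ (min ε₂ ε₃), by positivity, fun z hz => ?_⟩
    have hz₁ : z ∈ Metric.ball y ε₁ := Metric.ball_subset_ball (min_le_left _ _) hz
    have hz₂ : z ∈ Metric.ball y ε₂ := Metric.ball_subset_ball ((min_le_right _ _).trans (min_le_left _ _)) hz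
    have hz₃ : z ∈ Metric.ball y ε₃ := Metric.ball_subset_ball ((min_le_right _ _).trans (min_le_right _ _)) hz
    have hznorm : ‖z‖ < ρ := by simpa using hball₃ hz₃
    obtain ⟨mz, hmzU, hmzz⟩ := hball₂ hz₂
    refine ⟨hznorm, mz, hUW hmzU, hmzz, fun m' hm' hm'z => ?_⟩
    have hm'U : m' ∈ U := by
      by_contra hnot
      exact hball₁ hz₁ ⟨m', ⟨hm'.le, hnot⟩, hm'z⟩
    exact hinjU hm'U hmzU (by rw [hm'z, hmzz])
  have hManyOpen : IsOpen {y : EuclideanSpace ℝ (Fin 4) | Many y} := by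
    rw [Metric.isOpen_iff]
    rintro y ⟨a, b, ha, hb, hne, hay, hby⟩
    obtain ⟨ua, ub, hua, hub, haua, hbub, hdisj⟩ := t2_separation hne
    obtain ⟨Ua, hUa, haUa, hUaW, -, himga⟩ := exists_nhds_injOn_sigma hι hδ hδ1 hround hσ hσinj hσeq
      (by linarith : 0 < ι a 4) (hMplus.inter hua) ⟨ha, haua⟩
    obtain ⟨Ub, hUb, hbUb, hUbW, -, himgb⟩ := exists_nhds_injOn_sigma hι hδ hδ1 hround hσ hσinj hσeq
      (by linarith : 0 < ι b 4) (hMplus.inter hub) ⟨hb, hbub⟩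
    obtain ⟨εa, hεa, hballa⟩ := Metric.isOpen_iff.1 (himga Ua Subset.rfl hUa) y ⟨a, haUa, hay⟩
    obtain ⟨εb, hεb, hballb⟩ := Metric.isOpen_iff.1 (himgb Ub Subset.rfl hUb) y ⟨b, hbUb, hby⟩
    refine ⟨min εa εb, by positivity, fun z hz => ?_⟩
    obtain ⟨a', ha'U, ha'z⟩ := hballa (Metric.ball_subset_ball (min_le_left _ _) hz)
    obtain ⟨b', hb'U, hb'z⟩ := hballb (Metric.ball_subset_ball (min_le_right _ _) hz)
    have hne' : a' ≠ b' := by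
      intro h
      have h1 : a' ∈ ua := (hUaW ha'U).2
      have h2 : a' ∈ ub := h ▸ (hUbW hb'U).2
      exact Set.disjoint_left.1 hdisj h1 h2
    exact ⟨a', b', (hUaW ha'U).1, (hUbW hb'U).1, hne', ha'z, hb'z⟩
  have hNoneOpen : IsOpen {y : EuclideanSpace ℝ (Fin 4) | ‖y‖ < ρ ∧ None' y} := by
    rw [Metric.isOpen_iff]
    rintro y ⟨hy, hnone⟩
    have hC : IsClosed (σ '' {m : M | 1 - δ ≤ ι m 4}) := (hK.image hcont).isClosed
    have hy_not : y ∉ σ '' {m : M | 1 - δ ≤ ι m 4} := by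
      rintro ⟨c, hcK, hcy⟩
      have hcK' : 1 - δ ≤ ι c 4 := hcK
      exact hnone c (lt_height_of_norm_sigma_lt hround hσeq hcK' (by rw [hcy]; exact hy)) hcy
    obtain ⟨ε₁, hε₁, hball₁⟩ := Metric.isOpen_iff.1 hC.isOpen_compl y hy_not
    obtain ⟨ε₃, hε₃, hball₃⟩ :=
      Metric.isOpen_iff.1 (Metric.isOpen_ball (x := (0 : EuclideanSpace ℝ (Fin 4))) (ε := ρ)) y (by simpa using hy)
    refine ⟨min ε₁ ε₃, by positivity, fun z hz => ?_⟩
    have hz₁ : z ∈ Metric.ball y ε₁ := Metric.ball_subset_ball (min_le_left _ _) hz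
    have hz₃ : z ∈ Metric.ball y ε₃ := Metric.ball_subset_ball (min_le_right _ _) hz
    refine ⟨by simpa using hball₃ hz₃, fun m' hm' hm'z => ?_⟩
    exact hball₁ hz₁ ⟨m', hm'.le, hm'z⟩
  have hpre : IsPreconnected (Metric.ball (0 : EuclideanSpace ℝ (Fin 4)) ρ) :=
    (convex_ball (0 : EuclideanSpace ℝ (Fin 4)) ρ).isPreconnected
  obtain ⟨x₀, hx₀, hGood₀⟩ := exists_good_point_sigma hι hδ hδ1 hround hσ hσinj hσeq
  set V : Set (EuclideanSpace ℝ (Fin 4)) := {y | Many y} ∪ {y | ‖y‖ < ρ ∧ None' y} with hV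
  have hVopen : IsOpen V := hManyOpen.union hNoneOpen
  have hcover : Metric.ball (0 : EuclideanSpace ℝ (Fin 4)) ρ ⊆ {y | ‖y‖ < ρ ∧ Good y} ∪ V := fun y hy => by
    have hy' : ‖y‖ < ρ := by simpa using hy
    rcases htri y with h | h | h
    · exact Or.inl ⟨hy', h⟩
    · exact Or.inr (Or.inl h)
    · exact Or.inr (Or.inr ⟨hy', h⟩)
  by_contra hxnot
  have hxV : x ∈ V := by
    rcases htri x with h | h | h
    · exact absurd h hxnot
    · exact Or.inl h
    · exact Or.inr ⟨hx, h⟩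
  have hne1 : (Metric.ball (0 : EuclideanSpace ℝ (Fin 4)) ρ ∩ {y | ‖y‖ < ρ ∧ Good y}).Nonempty :=
    ⟨x₀, by simpa using hx₀, hx₀, hGood₀⟩
  have hne2 : (Metric.ball (0 : EuclideanSpace ℝ (Fin 4)) ρ ∩ V).Nonempty :=
    ⟨x, by simpa using hx, hxV⟩
  obtain ⟨y, -, ⟨-, hyGood⟩, hyV⟩ := hpre _ _ hGoodOpen hVopen hcover hne1 hne2
  obtain ⟨m₁, hm₁, hm₁y, huniq⟩ := hyGood
  rcases hyV with ⟨a, b, ha, hb, hne, hay, hby⟩ | ⟨-, hnone⟩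
  · exact hne ((huniq a ha hay).trans (huniq b hb hby).symm)
  · exact hnone m₁ hm₁ hm₁y

end Sigma

end Summit.SmoothPoincare4.SmoothPoincare4.Theorems.OrigamiFoldExistence.ShadowPleats

end
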